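import Mathlib.CategoryTheory.Sites.DenseSubsite.InducedTopology
import Mathlib.CategoryTheory.Sites.LocallyBijective
import Literature.AlgebraicGeometry.Motives.EtaleToProetLan
import HarnessLib

/-!
# The dense-subsite glue for Bhatt–Scholze Lemma 5.1.1, the site `X_proét^aff` of pro-étale affines
# (Def. 4.2.1) and the sheaf property of `Lan F` on it; Lemma 4.2.4 no longer a named fact

`EtaleToProetLan.lean` reduced Lemma 5.1.1 (and with it Lemma 5.1.2, Cor. 5.1.6 for constant
sheaves and `finite_proetCohomology_zmod_of_isProper`) to its residual content
`isIso_toSheafify_lan_app_of_presentation`: at a pro-étale affine `W = lim_i U_i` the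
sheafification map `(Lan F)(W) → (Lan F)^#(W) = ν*F(W)` is an isomorphism. In the printed proof
(arXiv p. 29) this is "It thus suffices to check that `F'` is a sheaf" — a statement about the site
`X_proét^aff` of pro-étale affines, which *generates* `X_proét` (Lemma 4.2.4, from Thm. 2.3.4). This
file holds the two formal ingredients of that route and the passage between them:

* **The glue, proved in general** (`isIso_toSheafify_app_of_isCoverDense`): for a fully faithful,
  cover-dense functor `G : C ⥤ (D, K)` and a presheaf `P` on `D` whose restriction `G.op ⋙ P` is a
  sheaf for the induced topology, the sheafification map `P → P^#` is an isomorphism at every object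
  `G c`. Proof: restricted to `C`, `P → P^#` is a morphism of sheaves for the induced topology which
  is locally injective and locally surjective there (a `K`-covering sieve of `G c` followed by the
  covers of its sources by objects of `C` pushes forward to a `K`-covering sieve,
  `functorPushforward_mem_of_forall`), hence an isomorphism.
* **Bhatt–Scholze Def. 4.2.1, the subcategory** (`isProetAffine`, `ProetAffine`,
  `proetAffineInclusion`, `proetAffineTopology`): the full subcategory `X_proét^aff ⊂ X_proét` of
  objects admitting a presentation (`ProetAffinePresentation`), with the induced topology.
* **The sheaf property of the presheaf pullback on `X_proét^aff` as a named fact**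
  (`isSheaf_lan_comp_proetAffineInclusion`; discharged in `EtaleToProetDensityProofs.lean`,
  `isSheaf_lan_comp_proetAffineInclusion_holds`): for every abelian étale sheaf `F`, the
  restriction of `Lan F` to `X_proét^aff` is a sheaf for the induced topology ("it suffices to check
  that `F'` is a sheaf", `F'(U) = colim F(U_i)` being `(Lan F)(U)` by Step A of `EtaleToProetLan.lean`).
* **The printed route, conditional** (`isIso_toSheafify_lan_app_of_presentation_of_dense`): under
  the cover density of `proetAffineInclusion X` (Lemma 4.2.4, an instance hypothesis) the sheaf
  property gives `isIso_toSheafify_lan_app_of_presentation` at `X`.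

**Lemma 4.2.4 is no longer vendored as a named fact.** An earlier version of this file stated
"the topos `Shv(X_proét)` is generated by `X_proét^aff`" (the cover density of
`proetAffineInclusion X` for every `X`) as the named fact `isCoverDense_proetAffineInclusion` and
derived Lemma 5.1.1, Lemma 5.1.2 and `finite_proetCohomology_zmod_of_isProper` from it. Its printed
proof is one line — "follows from Theorem 2.3.4" — but Theorem 2.3.4 (every weakly étale
`A → B` becomes ind-étale after a faithfully flat ind-étale extension of `B`; arXiv pp. 11–12) rests
on the w-local / w-strictly local rings of §2.1–2.2, henselization along ideals and Olivier's
theorem (Thm. 2.3.5), none of which Mathlib has (`RingTheory/Etale/Weakly.lean` stops at base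
change and composition): a theory, not a lemma. Meanwhile `EtaleToProetLanProofs.lean` discharged
`isIso_toSheafify_lan_app_of_presentation` — hence Lemma 5.1.1 and Lemma 5.1.2 — by a direct
argument on `X_proét` as Mathlib defines it (weakly étale `X`-schemes, fpqc covers) that never uses
Lemma 4.2.4. The named fact had thereby become an unused assumption and was removed (D-0026),
together with the four one-line corollaries that threaded it to Lemma 5.1.1, Lemma 5.1.2, the
comparison `Hⁱ(X_proét, ν*–) ≅ Hⁱ(X_ét, –)` and `finite_proetCohomology_zmod_of_isProper` (all now
reached through the `_holds` theorems of `EtaleToProetLanProofs.lean`). Statements that genuinely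
need the density — the description of the covering sieves of `X_proét^aff` as finite jointly
surjective families (`EtaleToProetCovers.lean`) and the conditional theorem below — carry it as the
instance hypothesis `[(proetAffineInclusion X).IsCoverDense (Scheme.ProEt.topology X)]`.

## References

* B. Bhatt, P. Scholze, *The pro-étale topology for schemes*, Astérisque 369 (2015)
  (arXiv:1309.1198, held; arXiv pages): Def. 4.2.1 and Lemma 4.2.4 (p. 24: "The site `X_proét` is
  subcanonical, and the topos `Shv(X_proét)` is generated by `X_proét^aff`. Proof. … The second
  assertion means that any `Y ∈ X_proét` admits a surjection `⊔_i U_i → Y` in `X_proét` with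
  `U_i ∈ X_proét^aff`, which follows from Theorem 2.3.4."), Remark 4.2.5, Lemma 5.1.1 (proof, p. 29);
  Thm. 2.3.4, Thm. 2.3.5 (Olivier), Remark 2.3.6 and Lemmas 2.3.7–2.3.8 (pp. 11–12: the ind-étale
  structure of weakly étale algebras behind Lemma 4.2.4). [BhattScholze2015]

## Design notes

* The glue is a general statement about sites (a corollary of the comparison lemma for dense
  subsites); it is kept in this file, in its own section with abstract universes, as the tree has no
  category-theory topic. It needs the concrete-category hypotheses of Mathlib's local
  injectivity/surjectivity API (`WEqualsLocallyBijective`, `HasSheafCompose (forget A)`), all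
  available for `Ab.{u+1}` on `X.ProEt` and on `ProetAffine X`.
* `isProetAffine X W := Nonempty (ProetAffinePresentation X W)` is a property (Def. 4.2.1: "if we can
  write `U = lim_i U_i`"); the induced topology on `ProetAffine X` is Mathlib's
  `Functor.inducedTopology`, which under cover density is the topology whose covering sieves are those
  generating a pro-étale covering sieve (`Functor.mem_inducedTopology_iff_of_isCoverDense`), i.e. the
  fpqc covers by pro-étale affines of Remark 4.2.5.
* Mathlib searches: `Functor.IsCoverDense`, `Functor.inducedTopology`, `Functor.IsDenseSubsite`,
  `Functor.IsCoverDense.sheafEquiv` (the comparison lemma; it does not directly give the value-wise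
  statement needed here), `Presheaf.equalizerSieve_mem`, `Presheaf.imageSieve_mem`,
  `Sheaf.isLocallyBijective_iff_isIso`. Nothing restated.
-/

universe w v₁ v₂ v₃ u₁ u₂ u₃ u

open CategoryTheory Limits Opposite AlgebraicGeometry

noncomputable section

namespace Literature.AlgebraicGeometry.Motives

/-! ### The glue: sheafification on a dense subsite where the presheaf is already a sheaf -/

section DenseSubsite

variable {C : Type u₁} [Category.{v₁} C] {D : Type u₂} [Category.{v₂} D] (G : C ⥤ D)
  [G.Full] [G.Faithful] (K : GrothendieckTopology D) [G.IsCoverDense K]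

omit [G.Faithful] in
/-- For `G : C ⥤ (D, K)` full and cover-dense, a sieve `T` on `c` pushes forward to a `K`-covering
sieve of `G c` as soon as it contains (the preimages of) all composites `G c' → W → G c` of an
arrow of some `K`-covering sieve `R` with an arrow from an object of `C` (transitivity of `K`
along `R`, each `W` being covered by objects of `C`). [folklore] -/
theorem functorPushforward_mem_of_forall (c : C) (T : Sieve c) (R : Sieve (G.obj c))
    (hR : R ∈ K (G.obj c))
    (hT : ∀ ⦃W : D⦄ (f : W ⟶ G.obj c), R f → ∀ ⦃c' : C⦄ (l : G.obj c' ⟶ W),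
      T (G.preimage (l ≫ f))) :
    T.functorPushforward G ∈ K (G.obj c) := by
  apply K.transitive hR
  intro W f hf
  refine K.superset_covering ?_ (G.is_cover_of_isCoverDense K W)
  rintro W' k ⟨⟨c'', lift, map, fac⟩⟩
  refine ⟨c'', G.preimage (map ≫ f), lift, hT f hf map, ?_⟩
  rw [G.map_preimage, ← Category.assoc, fac]

variable {A : Type u₃} [Category.{v₃} A] {FA : A → A → Type*} {CA : A → Type w}
  [∀ X Y, FunLike (FA X Y) (CA X) (CA Y)] [ConcreteCategory.{w} A FA]
  [HasWeakSheafify K A] [K.WEqualsLocallyBijective A]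

/-- Restricted to a full cover-dense subsite, the sheafification map `P → P^#` is locally injective
for the induced topology. [folklore] -/
theorem isLocallyInjective_whiskerLeft_toSheafify (P : Dᵒᵖ ⥤ A) :
    Presheaf.IsLocallyInjective (G.inducedTopology K) (G.op.whiskerLeft (toSheafify K P)) := by
  constructor
  intro c x y h
  have hR := Presheaf.equalizerSieve_mem K (toSheafify K P) x y h
  rw [Functor.mem_inducedTopology_iff_of_isCoverDense]
  refine functorPushforward_mem_of_forall G K _ _ _ hR ?_
  intro W f hf c' l
  change P.map (G.map (G.preimage (l ≫ f))).op x = P.map (G.map (G.preimage (l ≫ f))).op y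
  have hf' : P.map f.op x = P.map f.op y := hf
  rw [G.map_preimage, op_comp, P.map_comp, ConcreteCategory.comp_apply,
    ConcreteCategory.comp_apply, hf']

/-- Restricted to a full cover-dense subsite, the sheafification map `P → P^#` is locally surjective
for the induced topology. [folklore] -/
theorem isLocallySurjective_whiskerLeft_toSheafify (P : Dᵒᵖ ⥤ A) :
    Presheaf.IsLocallySurjective (G.inducedTopology K) (G.op.whiskerLeft (toSheafify K P)) := by
  constructor
  intro c s
  have hR := Presheaf.imageSieve_mem K (toSheafify K P) s
  rw [Functor.mem_inducedTopology_iff_of_isCoverDense]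
  refine functorPushforward_mem_of_forall G K _ _ _ hR ?_
  rintro W f ⟨t, ht⟩ c' l
  refine ⟨P.map l.op t, ?_⟩
  change (toSheafify K P).app _ (P.map l.op t) =
    (sheafify K P).map (G.map (G.preimage (l ≫ f))).op s
  rw [G.map_preimage, op_comp, Functor.map_comp, ConcreteCategory.comp_apply]
  exact (NatTrans.naturality_apply (toSheafify K P) l.op t).trans
    (congrArg ((sheafify K P).map l.op) ht)

variable [(G.inducedTopology K).HasSheafCompose (forget A)] [(forget A).ReflectsIsomorphisms]

include FA CA in
/-- **Sheafification does not change a presheaf on a dense subsite where it is already a sheaf.**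
For `G : C ⥤ (D, K)` fully faithful and cover-dense and a presheaf `P` on `D` such that `G.op ⋙ P`
is a sheaf for the induced topology, the sheafification map `(P → P^#)(G c)` is an isomorphism for
every `c ∈ C`: restricted to `C` it is a locally bijective morphism between sheaves for the induced
topology (`P^#` restricts to a sheaf as `G` is continuous), hence an isomorphism (Mathlib
`Sheaf.isLocallyBijective_iff_isIso`). [folklore] -/
theorem isIso_toSheafify_app_of_isCoverDense (P : Dᵒᵖ ⥤ A)
    (hP : Presheaf.IsSheaf (G.inducedTopology K) (G.op ⋙ P)) (c : C) :
    IsIso ((toSheafify K P).app (op (G.obj c))) := by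
  let F₁ : Sheaf (G.inducedTopology K) A := ⟨G.op ⋙ P, hP⟩
  let F₂ : Sheaf (G.inducedTopology K) A :=
    ⟨G.op ⋙ sheafify K P, G.op_comp_isSheaf (G.inducedTopology K) K ((presheafToSheaf K A).obj P)⟩
  let ψ : F₁ ⟶ F₂ := ObjectProperty.homMk (G.op.whiskerLeft (toSheafify K P))
  haveI : IsIso ψ := (Sheaf.isLocallyBijective_iff_isIso (FA := FA) ψ).1
    ⟨isLocallyInjective_whiskerLeft_toSheafify G K P,
      isLocallySurjective_whiskerLeft_toSheafify G K P⟩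
  haveI : IsIso ψ.hom := inferInstanceAs (IsIso ((sheafToPresheaf _ _).map ψ))
  exact inferInstanceAs (IsIso (ψ.hom.app (op c)))

end DenseSubsite

/-! ### `X_proét^aff` (Bhatt–Scholze Def. 4.2.1) and the sheaf property of `Lan F` on it -/

section ProetAffine

variable (X : Scheme.{u})

/-- **Pro-étale affines** (Bhatt–Scholze Def. 4.2.1): the property of `W ∈ X_proét` of admitting a
presentation `W = lim_i U_i` as a small cofiltered limit of affine schemes `U_i ∈ X_ét`
(`ProetAffinePresentation`). [cite: BhattScholze2015, Def. 4.2.1] -/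
def isProetAffine : ObjectProperty X.ProEt := fun W => Nonempty (ProetAffinePresentation X W)

/-- A presentation witnesses the property. [cite: BhattScholze2015, Def. 4.2.1] -/
theorem isProetAffine_of_presentation {W : X.ProEt} (𝔭 : ProetAffinePresentation X W) :
    isProetAffine X W :=
  ⟨𝔭⟩

/-- An affine `U ∈ X_ét` is a pro-étale affine (trivial presentation). [cite: BhattScholze2015, Def. 4.2.1] -/
theorem isProetAffine_etaleToProet_obj (U : X.Etale) [IsAffine U.left] :
    isProetAffine X ((etaleToProet X).obj U) :=
  ⟨ProetAffinePresentation.trivial X U⟩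

/-- **`X_proét^aff`**: "The full subcategory of `X_proét` spanned by pro-étale affines"
(Bhatt–Scholze Def. 4.2.1). [cite: BhattScholze2015, Def. 4.2.1] -/
abbrev ProetAffine : Type (u + 1) := (isProetAffine X).FullSubcategory

/-- The inclusion `X_proét^aff ⥤ X_proét` (fully faithful). [cite: BhattScholze2015, Def. 4.2.1] -/
abbrev proetAffineInclusion : ProetAffine X ⥤ X.ProEt := (isProetAffine X).ι

/-- The topology on `X_proét^aff` induced from `X_proét` (Mathlib `Functor.inducedTopology`; under
Lemma 4.2.4 its covering sieves are those generating a pro-étale covering sieve,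
`Functor.mem_inducedTopology_iff_of_isCoverDense` — the fpqc covers of Remark 4.2.5).
[cite: BhattScholze2015, Remark 4.2.5] -/
abbrev proetAffineTopology : GrothendieckTopology (ProetAffine X) :=
  (proetAffineInclusion X).inducedTopology (Scheme.ProEt.topology X)

/-- **The presheaf inverse image of an étale sheaf is a sheaf on `X_proét^aff`** (named fact;
discharged: `isSheaf_lan_comp_proetAffineInclusion_holds`, `EtaleToProetDensityProofs.lean`) — the
second step of the printed proof of Bhatt–Scholze Lemma 5.1.1: "The pullback
`F'` of `F` to `S` as a presheaf is given by `F'(B) = colim F(B_i)` [`(Lan F)(lim U_i) = colim F(U_i)`,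
Step A, `ProetAffinePresentation.isColimitLanCocone`]. It thus suffices to check that `F'` is a
sheaf", proved there for `X = Spec A` on the site `S ≃ X_proét^aff` of ind-étale `A`-algebras with
faithfully flat covers: `F'` is a Zariski sheaf (finitely many quasi-compact opens of `Spec B` come
from some `Spec B_i`), satisfies descent along an étale faithfully flat `B → C` (base changed from
some `B_i → C_i`, `F` being a sheaf), and along a general faithfully flat ind-étale
`B → C = colim C_j` by passing to the filtered colimit of the previous case. Read on Mathlib's
carriers: for every `Ab.{u+1}`-valued étale sheaf `F`, the restriction to `ProetAffine X` of the left
Kan extension `(etaleToProet X).op.lan.obj F.obj` is a sheaf for the induced topology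
`proetAffineTopology X`. [cite: BhattScholze2015, Lemma 5.1.1 (proof)] -/
def isSheaf_lan_comp_proetAffineInclusion : Prop :=
  ∀ (X : Scheme.{u}) (F : Sheaf X.smallEtaleTopology Ab.{u + 1}),
    Presheaf.IsSheaf (proetAffineTopology X)
      ((proetAffineInclusion X).op ⋙ (etaleToProet X).op.lan.obj F.obj)

end ProetAffine

/-! ### The printed route to Lemma 5.1.1, conditional on Lemma 4.2.4 -/

/-- **The residual content of Lemma 5.1.1 along the printed route** (conditional form). If the
pro-étale affines of `X` generate `X_proét` — Bhatt–Scholze Lemma 4.2.4: "the topos `Shv(X_proét)`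
is generated by `X_proét^aff`", i.e. "any `Y ∈ X_proét` admits a surjection `⊔_i U_i → Y` in
`X_proét` with `U_i ∈ X_proét^aff`, which follows from Theorem 2.3.4", read as the cover density of
`proetAffineInclusion X` (Mathlib `Functor.IsCoverDense`) and taken as an instance hypothesis, its
proof resting on the ind-étale structure theory of weakly étale algebras (Thm. 2.3.4, with
Olivier's Thm. 2.3.5 and Lemmas 2.3.7–2.3.8) that Mathlib lacks — then, `Lan F` being a sheaf on
`X_proét^aff` (`h₁`, the named fact `isSheaf_lan_comp_proetAffineInclusion`, discharged in
`EtaleToProetDensityProofs.lean`), the sheafification map `(Lan F)(W) → (Lan F)^#(W) = ν*F(W)` is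
an isomorphism at every pro-étale affine `W` of `X` (the glue `isIso_toSheafify_app_of_isCoverDense`).
The unconditional statement for all `X` is the named fact `isIso_toSheafify_lan_app_of_presentation`,
discharged in `EtaleToProetLanProofs.lean` without Lemma 4.2.4.
[cite: BhattScholze2015, Lemma 5.1.1 (proof) and Lemma 4.2.4] -/
theorem isIso_toSheafify_lan_app_of_presentation_of_dense (X : Scheme.{u})
    [(proetAffineInclusion X).IsCoverDense (Scheme.ProEt.topology X)]
    (h₁ : isSheaf_lan_comp_proetAffineInclusion.{u}) {W : X.ProEt}
    (𝔭 : ProetAffinePresentation X W) (F : Sheaf X.smallEtaleTopology Ab.{u + 1}) :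
    IsIso ((toSheafify (Scheme.ProEt.topology X) ((etaleToProet X).op.lan.obj F.obj)).app (op W)) :=
  isIso_toSheafify_app_of_isCoverDense (proetAffineInclusion X) (Scheme.ProEt.topology X)
    ((etaleToProet X).op.lan.obj F.obj) (h₁ X F) ⟨W, ⟨𝔭⟩⟩

end Literature.AlgebraicGeometry.Motives

end
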